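import Literature.NumberTheory.NumberFields.NarrowClassGroupCounting
import Literature.Geometry.Kaehler.ComplexTorusRealMultiplicationNarrowClassNumber
import HarnessLib

/-!
# The `2`-rank of the NARROW class group of a number field with ODD class number is its narrow defect:
# `[Cl⁺_K : (Cl⁺_K)²] = [P_K : P_K⁺] = h⁺_K / h_K` (`= #(U⁺/U²)` for totally real `K`)

Topic `NumberTheory/NumberFields` (namespace = path).  THEOREM-ONLY file (no definition, no named fact, no instance, no `sorry`),
written by the prover seat `bsd-2adic-k4-w1` GEN 10 (cell `bsd-2adic`; `--supports` stmt-BirchSwinnertonDyer-22615: the per-row input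
`[Cl⁺(L) : Cl⁺(L)²] = [Cl⁺(F) : Cl⁺(F)²]` of the narrow-Fukuda door `conjA_two_cubicModel_of_narrowRank_sqrtTwo_model` (p740352) is
decided, for fields with ODD class number, by unit signatures alone).

Fröhlich–Taylor, *Algebraic Number Theory*, Ch. V §1 (1.8)–(1.13): the natural map `π_N : C_N⁺ → C_N` is onto with kernel
`P_N/P_N⁺ ≅ N^*/N₊U_N`, a group killed by `2` (`(a)² = (a²)`, `a²` totally positive) of order `h⁺/h`; (1.12)–(1.13) compute
`[N^* : N₊U_N] · #sign(U_N) = 2^s`.  The tree has the lower bound `[P_K : P_K⁺] ∣ [Cl⁺_K : (Cl⁺_K)²]`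
(`relIndex_totPosPrincipalIdeals_dvd_index_range_pow_two`, cruxlead-19573-w2 GEN 9).  Here the EQUALITY when `h_K` is odd: then the
`2`-primary part of `Cl⁺_K` lies in `ker π_K = P_K/P_K⁺` (its image in `Cl⁺_K/(P_K/P_K⁺)`, a group of order `h_K`, is a `2`-group of odd
order), so `Cl⁺_K[2] = P_K/P_K⁺` and `[Cl⁺_K : (Cl⁺_K)²] = #Cl⁺_K[2] = [P_K : P_K⁺] = h⁺_K/h_K`; for `K` totally real this is the narrow
defect `#(U⁺/U²)` (`h⁺ = h · #(U⁺/U²)`, tree `narrowClassNumber_eq_classNumber_mul_card_totPosUnitsModSq`).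

* `index_range_pow_two_narrowClassGroup_eq_relIndex_of_odd_classNumber` — `h_K` odd ⟹ `[Cl⁺_K : (Cl⁺_K)²] = [P_K : P_K⁺]`.
* `index_range_pow_two_narrowClassGroup_mul_classNumber_eq_of_odd_classNumber` — `⟹ [Cl⁺_K : (Cl⁺_K)²] · h_K = h⁺_K`.
* `index_range_pow_two_narrowClassGroup_eq_card_totPosUnitsModSq_of_odd_classNumber` — `K` totally real, `h_K` odd ⟹
  `[Cl⁺_K : (Cl⁺_K)²] = #(U⁺/U²)(K)`: the narrow `2`-rank is the number of independent totally positive units modulo squares.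

References: [FrohlichTaylor1990] Ch. V §1 (1.8)–(1.13), pp. 163–164; [NeukirchANT1999] Ch. VI §1 Def. (1.7), Prop. (1.9);
[Washington1997] §13.3 (p-ranks); [Lange2023AbelianVarietiesComplex] §2.4.5 Ex. (15) (`#U⁺/U² = h⁺/h`).
-/

noncomputable section

open scoped NumberField nonZeroDivisors
open NumberField IsDedekindDomain

namespace Literature.NumberTheory.NumberFields

open Literature.NumberTheory.GaloisRepresentations Literature.Geometry.Kaehler.ComplexTorus

variable {K : Type} [Field K] [NumberField K]

/-- **`h_K` odd ⟹ `[Cl⁺_K : (Cl⁺_K)²] = [P_K : P_K⁺]`.**  The kernel `V = P_K/P_K⁺` of `Cl⁺_K ↠ Cl_K` is killed by `2`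
(`(a)² = (a²)`, `a²` totally positive) and has index `h_K` in `Cl⁺_K`; when `h_K` is odd every `c` with `c² = 1` maps to an element of
order dividing `2` and `h_K` in `Cl⁺_K/V`, i.e. to `1`, so `Cl⁺_K[2] = V` and `[Cl⁺_K : (Cl⁺_K)²] = #Cl⁺_K[2] = #V = [P_K : P_K⁺]`.
[cite: FrohlichTaylor1990, Ch. V §1 (1.8)–(1.13), pp. 163–164] [cite: NeukirchANT1999, Ch. VI §1 Def. (1.7)] -/
theorem index_range_pow_two_narrowClassGroup_eq_relIndex_of_odd_classNumber (hodd : Odd (classNumber K)) :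
    (powMonoidHom (α := NarrowClassGroup K) 2).range.index =
      (totPosPrincipalIdeals K).relIndex (toPrincipalIdeal (𝓞 K) K).range := by
  classical
  haveI : Finite (NarrowClassGroup K) := finite_rayClassGroup top_ne_bot
  -- the image `V` of the principal ideals in `Cl⁺ = J/P⁺` (as in `relIndex_totPosPrincipalIdeals_dvd_index_range_pow_two`)
  set T : Subgroup (FractionalIdeal (𝓞 K)⁰ K)ˣ := idealsPrimeTo (⊤ : Ideal (𝓞 K)) with hT
  set R : Subgroup T := (ray (⊤ : Ideal (𝓞 K))).subgroupOf T with hR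
  set π : T →* NarrowClassGroup K := QuotientGroup.mk' R with hπ
  have hπsurj : Function.Surjective π := QuotientGroup.mk'_surjective R
  set V : Subgroup (NarrowClassGroup K) := ((toPrincipalIdeal (𝓞 K) K).range.subgroupOf T).map π with hV
  -- `V` is killed by `2`
  have hVker : V ≤ (powMonoidHom (α := NarrowClassGroup K) 2).ker := by
    rintro _ ⟨I, hI, rfl⟩
    obtain ⟨x, hx⟩ := Subgroup.mem_subgroupOf.mp hI
    rw [MonoidHom.mem_ker, powMonoidHom_apply, ← map_pow, hπ, QuotientGroup.mk'_apply, QuotientGroup.eq_one_iff, hR,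
      Subgroup.mem_subgroupOf, ray_top, Subgroup.coe_pow]
    refine ⟨x ^ 2, ?_, by rw [map_pow, hx]⟩
    rw [SetLike.mem_coe, MonoidHom.mem_ker, map_pow, ← ofAdd_toAdd (signHom K x), ← ofAdd_nsmul, two_nsmul]
    have : Multiplicative.toAdd (signHom K x) + Multiplicative.toAdd (signHom K x) = 0 := by
      funext σ
      rw [Pi.add_apply, Pi.zero_apply]
      generalize Multiplicative.toAdd (signHom K x) σ = a
      fin_cases a <;> decide
    rw [this, ofAdd_zero]
  -- `V` has index `h_K`
  have hVindex : V.index = classNumber K := by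
    rw [hV, Subgroup.index_map, hπ, QuotientGroup.ker_mk', MonoidHom.range_eq_top.mpr hπsurj, Subgroup.index_top, mul_one,
      sup_eq_left.mpr, ← Subgroup.relIndex, hT, idealsPrimeTo_top, Subgroup.relIndex_top_right, classNumber_eq_index]
    rw [hR, ray_top]
    intro x hx
    exact Subgroup.mem_subgroupOf.mpr (totPosPrincipalIdeals_le_range K (Subgroup.mem_subgroupOf.mp hx))
  have hVcard : Nat.card V = (totPosPrincipalIdeals K).relIndex (toPrincipalIdeal (𝓞 K) K).range := by
    have h1 : V.index * Nat.card V = Nat.card (NarrowClassGroup K) := V.index_mul_card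
    rw [hVindex] at h1
    change _ = narrowClassNumber K at h1
    rw [narrowClassNumber_eq_classNumber_mul_relIndex] at h1
    exact Nat.eq_of_mul_eq_mul_left (classNumber_pos K) h1
  -- `h_K` odd: the `2`-torsion of `Cl⁺` lies in `V` (its image in `Cl⁺/V`, of odd order `h_K`, is killed by `2`)
  have hkerV : (powMonoidHom (α := NarrowClassGroup K) 2).ker ≤ V := by
    intro c hc
    rw [MonoidHom.mem_ker, powMonoidHom_apply] at hc
    have h2 : orderOf (QuotientGroup.mk (s := V) c) ∣ 2 := by
      apply orderOf_dvd_of_pow_eq_one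
      rw [← QuotientGroup.mk_pow, hc, QuotientGroup.mk_one]
    have hh : orderOf (QuotientGroup.mk (s := V) c) ∣ classNumber K := by
      rw [← hVindex, Subgroup.index_eq_card]
      exact orderOf_dvd_natCard _
    have h1 : orderOf (QuotientGroup.mk (s := V) c) = 1 := by
      have hdvd : orderOf (QuotientGroup.mk (s := V) c) ∣ Nat.gcd 2 (classNumber K) := Nat.dvd_gcd h2 hh
      have hg : Nat.gcd 2 (classNumber K) = 1 := by
        rcases hodd with ⟨m, hm⟩
        rw [hm, Nat.gcd_comm, Nat.gcd_rec]
        norm_num [Nat.add_mul_mod_self_left, Nat.mul_mod_right]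
      rw [hg] at hdvd
      exact Nat.dvd_one.mp hdvd
    exact (QuotientGroup.eq_one_iff c).mp (orderOf_eq_one_iff.mp h1)
  rw [index_range_powMonoidHom_eq_card_ker', ← hVcard]
  exact congrArg Nat.card (congrArg (fun H : Subgroup (NarrowClassGroup K) => (H : Type _)) (le_antisymm hkerV hVker))

/-- **`h_K` odd ⟹ `[Cl⁺_K : (Cl⁺_K)²] · h_K = h⁺_K`** (Fröhlich–Taylor (1.8)–(1.9): `h⁺ = h · [P_K : P_K⁺]`).
[cite: FrohlichTaylor1990, Ch. V §1 (1.8)–(1.9), p. 163] -/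
theorem index_range_pow_two_narrowClassGroup_mul_classNumber_eq_of_odd_classNumber (hodd : Odd (classNumber K)) :
    (powMonoidHom (α := NarrowClassGroup K) 2).range.index * classNumber K = narrowClassNumber K := by
  rw [index_range_pow_two_narrowClassGroup_eq_relIndex_of_odd_classNumber hodd, mul_comm,
    ← narrowClassNumber_eq_classNumber_mul_relIndex]

/-- **`K` totally real with `h_K` odd ⟹ `[Cl⁺_K : (Cl⁺_K)²] = #(U⁺/U²)(K)`**: the narrow `2`-rank of a totally real field with odd
class number is its narrow defect `ord₂(h⁺/h)`, i.e. the number of independent totally positive units modulo squares — a finite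
UNIT-SIGNATURE datum (`h⁺ = h · #(U⁺/U²)`, Lange §2.4.5 Ex. (15)). [cite: FrohlichTaylor1990, Ch. V §1 (1.12)–(1.13), p. 164]
[cite: Lange2023AbelianVarietiesComplex, §2.4.5 Ex. (15), p. 127] -/
theorem index_range_pow_two_narrowClassGroup_eq_card_totPosUnitsModSq_of_odd_classNumber [IsTotallyReal K]
    (hodd : Odd (classNumber K)) :
    (powMonoidHom (α := NarrowClassGroup K) 2).range.index = Nat.card (TotPosUnitsModSq K) := by
  have h := index_range_pow_two_narrowClassGroup_mul_classNumber_eq_of_odd_classNumber hodd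
  rw [narrowClassNumber_eq_classNumber_mul_card_totPosUnitsModSq, mul_comm (classNumber K)] at h
  exact Nat.eq_of_mul_eq_mul_right (classNumber_pos K) h

end Literature.NumberTheory.NumberFields

end
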